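import Summits.KontsevichZagierPeriods.Zeta5Search.Certificates.RayC5DualNumerics
import HarnessLib

/-!
# ζ(5) search — certificates: the dual series of the ray RayC5 (`e = 1`: the partner b′) — the WINDOW bound
(cell `pub-zeta5`, P1 g11; port of certifier 2's `RecordRayDualSeriesWindow/Rate`)

HONEST FRAMING: systematic search; no irrationality claim unless certified.

OUR work (Summit side). `Hc5E1 n μ` = the entropy combination of `log T̂(μ)` for `B = BC5E 1 n`;
`Hc5E1_window_le` (tangent bounds keeping the cancellation), `slopec5E1_le` (the window slope is `≤ Λ⁺` for `n ≥ 100`),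
`Hc5E1_base_le` (floor stability at `μ₀ = u₀n − 1`), and **`Hc5E1_window_bound`**:
`H(n, μ) ≤ n·(ĥ(2/5) + Λ⁺/20) + 2Λ⁺ + 96(1 + log(52n))` on `u₀n − 1 ≤ μ ≤ u₁n + 1` (`n ≥ 100`; `[u₀,u₁] = [9 / 40, 1 / 4]`, `w = u₁ − u₀`).
-/

noncomputable section

open Finset Real

namespace Summit.KontsevichZagierPeriods.Zeta5Search.RayC5

open Summit.KontsevichZagierPeriods.Zeta5Search.RecordRay (ent ent_shift_le ent_shift_ge log_le_log_sub ent_scale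
  ent_pred_le ent_pred_ge ent_ge_of_near)

/-- `H(n, μ) = ent(51n+μ+1, μ) − Σ_j ent(m_j, k_j)` for `B = BC5E 1 n`. -/
def Hc5E1 (n μ : ℝ) : ℝ :=
  ent (51 * n + μ + 1) μ - (ent (30 * n + μ + 1) (21 * n + μ) + ent (32 * n + μ + 1) (19 * n + μ) + ent (33 * n + μ + 1) (18 * n + μ) + ent (35 * n + μ + 1) (16 * n + μ) + ent (36 * n + μ + 1) (15 * n + μ) + ent (38 * n + μ + 1) (13 * n + μ) + ent (39 * n + μ) (12 * n + μ + 1))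

/-- The explicit slope of the window inequality. -/
def slopec5E1 (n μ₀ μ₁ : ℝ) : ℝ :=
  (Real.log (51 * n + μ₁ + 1) - Real.log μ₀) - ((Real.log (30 * n + μ₀ + 1) - Real.log (21 * n + μ₁)) + (Real.log (32 * n + μ₀ + 1) - Real.log (19 * n + μ₁)) + (Real.log (33 * n + μ₀ + 1) - Real.log (18 * n + μ₁)) + (Real.log (35 * n + μ₀ + 1) - Real.log (16 * n + μ₁)) + (Real.log (36 * n + μ₀ + 1) - Real.log (15 * n + μ₁)) + (Real.log (38 * n + μ₀ + 1) - Real.log (13 * n + μ₁)) + (Real.log (39 * n + μ₀) - Real.log (12 * n + μ₁ + 1)))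

set_option maxHeartbeats 800000 in
-- fourteen tangent inequalities assembled by one `linarith`
/-- **Window inequality**: for `1 ≤ n`, `0 < μ₀ ≤ μ ≤ μ₁`: `H(n, μ) ≤ H(n, μ₀) + (μ − μ₀)·slope(n, μ₀, μ₁)`. -/
theorem Hc5E1_window_le {n μ₀ μ μ₁ : ℝ} (hn : 1 ≤ n) (h0 : 0 < μ₀) (h01 : μ₀ ≤ μ) (h1 : μ ≤ μ₁) :
    Hc5E1 n μ ≤ Hc5E1 n μ₀ + (μ - μ₀) * slopec5E1 n μ₀ μ₁ := by
  have hδ : 0 ≤ μ - μ₀ := by linarith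
  have hnum := ent_shift_le (m := 51 * n + μ₀ + 1) (k := μ₀) (δ := μ - μ₀) (by linarith) h0 hδ
  have hnum' : (μ - μ₀) * (Real.log (51 * n + μ₀ + 1 + (μ - μ₀)) - Real.log μ₀) ≤
      (μ - μ₀) * (Real.log (51 * n + μ₁ + 1) - Real.log μ₀) := by
    apply mul_le_mul_of_nonneg_left _ hδ
    have := Real.log_le_log (by linarith : 0 < 51 * n + μ₀ + 1 + (μ - μ₀)) (by linarith : 51 * n + μ₀ + 1 + (μ - μ₀) ≤ 51 * n + μ₁ + 1)
    linarith
  have en : 51 * n + μ₀ + 1 + (μ - μ₀) = 51 * n + μ + 1 := by ring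
  have ek : μ₀ + (μ - μ₀) = μ := by ring
  rw [en, ek] at hnum
  rw [en] at hnum'
  have hd0 : (μ - μ₀) * (Real.log (30 * n + μ₀ + 1) - Real.log (21 * n + μ₁)) ≤ ent (30 * n + μ + 1) (21 * n + μ) - ent (30 * n + μ₀ + 1) (21 * n + μ₀) := by
    have h := ent_shift_ge (m := (30 * n + μ₀ + 1)) (k := (21 * n + μ₀)) (δ := μ - μ₀) (by linarith) (by linarith) hδ
    have eM : (30 * n + μ₀ + 1) + (μ - μ₀) = (30 * n + μ + 1) := by ring
    have eK : (21 * n + μ₀) + (μ - μ₀) = (21 * n + μ) := by ring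
    rw [eM, eK] at h
    have hmono : Real.log (21 * n + μ) ≤ Real.log (21 * n + μ₁) := Real.log_le_log (by linarith) (by linarith)
    have hmul : (μ - μ₀) * (Real.log (30 * n + μ₀ + 1) - Real.log (21 * n + μ₁)) ≤ (μ - μ₀) * (Real.log (30 * n + μ₀ + 1) - Real.log (21 * n + μ)) := by
      apply mul_le_mul_of_nonneg_left _ hδ; linarith
    linarith
  have hd1 : (μ - μ₀) * (Real.log (32 * n + μ₀ + 1) - Real.log (19 * n + μ₁)) ≤ ent (32 * n + μ + 1) (19 * n + μ) - ent (32 * n + μ₀ + 1) (19 * n + μ₀) := by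
    have h := ent_shift_ge (m := (32 * n + μ₀ + 1)) (k := (19 * n + μ₀)) (δ := μ - μ₀) (by linarith) (by linarith) hδ
    have eM : (32 * n + μ₀ + 1) + (μ - μ₀) = (32 * n + μ + 1) := by ring
    have eK : (19 * n + μ₀) + (μ - μ₀) = (19 * n + μ) := by ring
    rw [eM, eK] at h
    have hmono : Real.log (19 * n + μ) ≤ Real.log (19 * n + μ₁) := Real.log_le_log (by linarith) (by linarith)
    have hmul : (μ - μ₀) * (Real.log (32 * n + μ₀ + 1) - Real.log (19 * n + μ₁)) ≤ (μ - μ₀) * (Real.log (32 * n + μ₀ + 1) - Real.log (19 * n + μ)) := by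
      apply mul_le_mul_of_nonneg_left _ hδ; linarith
    linarith
  have hd2 : (μ - μ₀) * (Real.log (33 * n + μ₀ + 1) - Real.log (18 * n + μ₁)) ≤ ent (33 * n + μ + 1) (18 * n + μ) - ent (33 * n + μ₀ + 1) (18 * n + μ₀) := by
    have h := ent_shift_ge (m := (33 * n + μ₀ + 1)) (k := (18 * n + μ₀)) (δ := μ - μ₀) (by linarith) (by linarith) hδ
    have eM : (33 * n + μ₀ + 1) + (μ - μ₀) = (33 * n + μ + 1) := by ring
    have eK : (18 * n + μ₀) + (μ - μ₀) = (18 * n + μ) := by ring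
    rw [eM, eK] at h
    have hmono : Real.log (18 * n + μ) ≤ Real.log (18 * n + μ₁) := Real.log_le_log (by linarith) (by linarith)
    have hmul : (μ - μ₀) * (Real.log (33 * n + μ₀ + 1) - Real.log (18 * n + μ₁)) ≤ (μ - μ₀) * (Real.log (33 * n + μ₀ + 1) - Real.log (18 * n + μ)) := by
      apply mul_le_mul_of_nonneg_left _ hδ; linarith
    linarith
  have hd3 : (μ - μ₀) * (Real.log (35 * n + μ₀ + 1) - Real.log (16 * n + μ₁)) ≤ ent (35 * n + μ + 1) (16 * n + μ) - ent (35 * n + μ₀ + 1) (16 * n + μ₀) := by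
    have h := ent_shift_ge (m := (35 * n + μ₀ + 1)) (k := (16 * n + μ₀)) (δ := μ - μ₀) (by linarith) (by linarith) hδ
    have eM : (35 * n + μ₀ + 1) + (μ - μ₀) = (35 * n + μ + 1) := by ring
    have eK : (16 * n + μ₀) + (μ - μ₀) = (16 * n + μ) := by ring
    rw [eM, eK] at h
    have hmono : Real.log (16 * n + μ) ≤ Real.log (16 * n + μ₁) := Real.log_le_log (by linarith) (by linarith)
    have hmul : (μ - μ₀) * (Real.log (35 * n + μ₀ + 1) - Real.log (16 * n + μ₁)) ≤ (μ - μ₀) * (Real.log (35 * n + μ₀ + 1) - Real.log (16 * n + μ)) := by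
      apply mul_le_mul_of_nonneg_left _ hδ; linarith
    linarith
  have hd4 : (μ - μ₀) * (Real.log (36 * n + μ₀ + 1) - Real.log (15 * n + μ₁)) ≤ ent (36 * n + μ + 1) (15 * n + μ) - ent (36 * n + μ₀ + 1) (15 * n + μ₀) := by
    have h := ent_shift_ge (m := (36 * n + μ₀ + 1)) (k := (15 * n + μ₀)) (δ := μ - μ₀) (by linarith) (by linarith) hδ
    have eM : (36 * n + μ₀ + 1) + (μ - μ₀) = (36 * n + μ + 1) := by ring
    have eK : (15 * n + μ₀) + (μ - μ₀) = (15 * n + μ) := by ring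
    rw [eM, eK] at h
    have hmono : Real.log (15 * n + μ) ≤ Real.log (15 * n + μ₁) := Real.log_le_log (by linarith) (by linarith)
    have hmul : (μ - μ₀) * (Real.log (36 * n + μ₀ + 1) - Real.log (15 * n + μ₁)) ≤ (μ - μ₀) * (Real.log (36 * n + μ₀ + 1) - Real.log (15 * n + μ)) := by
      apply mul_le_mul_of_nonneg_left _ hδ; linarith
    linarith
  have hd5 : (μ - μ₀) * (Real.log (38 * n + μ₀ + 1) - Real.log (13 * n + μ₁)) ≤ ent (38 * n + μ + 1) (13 * n + μ) - ent (38 * n + μ₀ + 1) (13 * n + μ₀) := by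
    have h := ent_shift_ge (m := (38 * n + μ₀ + 1)) (k := (13 * n + μ₀)) (δ := μ - μ₀) (by linarith) (by linarith) hδ
    have eM : (38 * n + μ₀ + 1) + (μ - μ₀) = (38 * n + μ + 1) := by ring
    have eK : (13 * n + μ₀) + (μ - μ₀) = (13 * n + μ) := by ring
    rw [eM, eK] at h
    have hmono : Real.log (13 * n + μ) ≤ Real.log (13 * n + μ₁) := Real.log_le_log (by linarith) (by linarith)
    have hmul : (μ - μ₀) * (Real.log (38 * n + μ₀ + 1) - Real.log (13 * n + μ₁)) ≤ (μ - μ₀) * (Real.log (38 * n + μ₀ + 1) - Real.log (13 * n + μ)) := by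
      apply mul_le_mul_of_nonneg_left _ hδ; linarith
    linarith
  have hd6 : (μ - μ₀) * (Real.log (39 * n + μ₀) - Real.log (12 * n + μ₁ + 1)) ≤ ent (39 * n + μ) (12 * n + μ + 1) - ent (39 * n + μ₀) (12 * n + μ₀ + 1) := by
    have h := ent_shift_ge (m := (39 * n + μ₀)) (k := (12 * n + μ₀ + 1)) (δ := μ - μ₀) (by linarith) (by linarith) hδ
    have eM : (39 * n + μ₀) + (μ - μ₀) = (39 * n + μ) := by ring
    have eK : (12 * n + μ₀ + 1) + (μ - μ₀) = (12 * n + μ + 1) := by ring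
    rw [eM, eK] at h
    have hmono : Real.log (12 * n + μ + 1) ≤ Real.log (12 * n + μ₁ + 1) := Real.log_le_log (by linarith) (by linarith)
    have hmul : (μ - μ₀) * (Real.log (39 * n + μ₀) - Real.log (12 * n + μ₁ + 1)) ≤ (μ - μ₀) * (Real.log (39 * n + μ₀) - Real.log (12 * n + μ + 1)) := by
      apply mul_le_mul_of_nonneg_left _ hδ; linarith
    linarith
  unfold Hc5E1 slopec5E1
  rw [mul_sub]
  linarith [hd0, hd1, hd2, hd3, hd4, hd5, hd6, hnum, hnum']

/-- **The slope of the window is `≤ Λ⁺`** for `n ≥ 100` (`μ₀ = u₀n − 1`, `μ₁ = u₁n + 1`). -/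
theorem slopec5E1_le {n : ℝ} (hn : 100 ≤ n) :
    slopec5E1 n (9 / 40 * n - 1) (1 / 4 * n + 1) ≤ lambdaPlusc5 := by
  unfold slopec5E1 lambdaPlusc5
  have h0 : 0 < 9 / 40 * n - 1 := by nlinarith
  have hnum : Real.log (51 * n + (1 / 4 * n + 1) + 1) - Real.log (9 / 40 * n - 1) ≤ Real.log 240 := by
    have h := Real.log_le_log (by linarith : 0 < 51 * n + (1 / 4 * n + 1) + 1)
      (show 51 * n + (1 / 4 * n + 1) + 1 ≤ 240 * (9 / 40 * n - 1) by linarith)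
    rw [Real.log_mul (by norm_num) h0.ne'] at h
    linarith
  have e0 := log_le_log_sub (a := 30 * n + (9 / 40 * n - 1) + 1) (b := 21 * n + (1 / 4 * n + 1)) (c := 6043 / 4254)
    (by linarith) (by norm_num) (by linarith)
  have e1 := log_le_log_sub (a := 32 * n + (9 / 40 * n - 1) + 1) (b := 19 * n + (1 / 4 * n + 1)) (c := 6443 / 3854)
    (by linarith) (by norm_num) (by linarith)
  have e2 := log_le_log_sub (a := 33 * n + (9 / 40 * n - 1) + 1) (b := 18 * n + (1 / 4 * n + 1)) (c := 949 / 522)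
    (by linarith) (by norm_num) (by linarith)
  have e3 := log_le_log_sub (a := 35 * n + (9 / 40 * n - 1) + 1) (b := 16 * n + (1 / 4 * n + 1)) (c := 7043 / 3254)
    (by linarith) (by norm_num) (by linarith)
  have e4 := log_le_log_sub (a := 36 * n + (9 / 40 * n - 1) + 1) (b := 15 * n + (1 / 4 * n + 1)) (c := 7243 / 3054)
    (by linarith) (by norm_num) (by linarith)
  have e5 := log_le_log_sub (a := 38 * n + (9 / 40 * n - 1) + 1) (b := 13 * n + (1 / 4 * n + 1)) (c := 7643 / 2654)
    (by linarith) (by norm_num) (by linarith)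
  have e6 := log_le_log_sub (a := 39 * n + (9 / 40 * n - 1)) (b := 12 * n + (1 / 4 * n + 1) + 1) (c := 7843 / 2454)
    (by linarith) (by norm_num) (by linarith)
  norm_num only at e0 e1 e2 e3 e4 e5 e6 ⊢
  linarith

/-- **Base value**: `H(n, u₀n − 1) ≤ n·ĥ(u₀) + 96·(1 + log(52n))` for `n ≥ 10`. -/
theorem Hc5E1_base_le {n : ℝ} (hn : 10 ≤ n) :
    Hc5E1 n (9 / 40 * n - 1) ≤ n * hhatc5 + 96 * (1 + Real.log (52 * n)) := by
  have hn0 : 0 < n := by linarith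
  have eN : ent (51 * n + (9 / 40 * n - 1) + 1) (9 / 40 * n - 1) = ent (2049 / 40 * n) (9 / 40 * n - 1) := by congr 1; ring
  have e0 : ent (30 * n + (9 / 40 * n - 1) + 1) (21 * n + (9 / 40 * n - 1)) = ent (1209 / 40 * n) (849 / 40 * n - 1) := by congr 1 <;> ring
  have e1 : ent (32 * n + (9 / 40 * n - 1) + 1) (19 * n + (9 / 40 * n - 1)) = ent (1289 / 40 * n) (769 / 40 * n - 1) := by congr 1 <;> ring
  have e2 : ent (33 * n + (9 / 40 * n - 1) + 1) (18 * n + (9 / 40 * n - 1)) = ent (1329 / 40 * n) (729 / 40 * n - 1) := by congr 1 <;> ring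
  have e3 : ent (35 * n + (9 / 40 * n - 1) + 1) (16 * n + (9 / 40 * n - 1)) = ent (1409 / 40 * n) (649 / 40 * n - 1) := by congr 1 <;> ring
  have e4 : ent (36 * n + (9 / 40 * n - 1) + 1) (15 * n + (9 / 40 * n - 1)) = ent (1449 / 40 * n) (609 / 40 * n - 1) := by congr 1 <;> ring
  have e5 : ent (38 * n + (9 / 40 * n - 1) + 1) (13 * n + (9 / 40 * n - 1)) = ent (1529 / 40 * n) (529 / 40 * n - 1) := by congr 1 <;> ring
  have e6 : ent (39 * n + (9 / 40 * n - 1)) (12 * n + (9 / 40 * n - 1) + 1) = ent (1569 / 40 * n - 1) (489 / 40 * n) := by congr 1 <;> ring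
  unfold Hc5E1
  rw [eN, e0, e1, e2, e3, e4, e5, e6]
  have aN := ent_pred_le (m := 2049 / 40 * n) (k := 9 / 40 * n) (M := 52 * n) (by linarith only [hn]) (by linarith only [hn]) (by linarith only [hn])
  have b0 := ent_pred_ge (m := 1209 / 40 * n) (k := 849 / 40 * n) (M := 52 * n) (by linarith only [hn]) (by linarith only [hn]) (by linarith only [hn])
  have b1 := ent_pred_ge (m := 1289 / 40 * n) (k := 769 / 40 * n) (M := 52 * n) (by linarith only [hn]) (by linarith only [hn]) (by linarith only [hn])
  have b2 := ent_pred_ge (m := 1329 / 40 * n) (k := 729 / 40 * n) (M := 52 * n) (by linarith only [hn]) (by linarith only [hn]) (by linarith only [hn])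
  have b3 := ent_pred_ge (m := 1409 / 40 * n) (k := 649 / 40 * n) (M := 52 * n) (by linarith only [hn]) (by linarith only [hn]) (by linarith only [hn])
  have b4 := ent_pred_ge (m := 1449 / 40 * n) (k := 609 / 40 * n) (M := 52 * n) (by linarith only [hn]) (by linarith only [hn]) (by linarith only [hn])
  have b5 := ent_pred_ge (m := 1529 / 40 * n) (k := 529 / 40 * n) (M := 52 * n) (by linarith only [hn]) (by linarith only [hn]) (by linarith only [hn])
  have b6 := ent_ge_of_near (m := 1569 / 40 * n - 1) (k := 489 / 40 * n) (m' := 1569 / 40 * n) (k' := 489 / 40 * n) (M := 52 * n)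
    (by linarith only [hn]) (by linarith only [hn]) (by linarith only [hn]) (by linarith only [hn]) (by linarith only [hn]) (by linarith only [hn])
    (by rw [abs_le]; constructor <;> linarith) (by simp)
  have sN := ent_scale hn0 (2049 / 40) (9 / 40)
  have s0 := ent_scale hn0 (1209 / 40) (849 / 40)
  have s1 := ent_scale hn0 (1289 / 40) (769 / 40)
  have s2 := ent_scale hn0 (1329 / 40) (729 / 40)
  have s3 := ent_scale hn0 (1409 / 40) (649 / 40)
  have s4 := ent_scale hn0 (1449 / 40) (609 / 40)
  have s5 := ent_scale hn0 (1529 / 40) (529 / 40)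
  have s6 := ent_scale hn0 (1569 / 40) (489 / 40)
  have hh : n * hhatc5 = n * ent (2049 / 40) (9 / 40) - (n * ent (1209 / 40) (849 / 40) + n * ent (1289 / 40) (769 / 40) + n * ent (1329 / 40) (729 / 40) + n * ent (1409 / 40) (649 / 40) + n * ent (1449 / 40) (609 / 40) + n * ent (1529 / 40) (529 / 40) + n * ent (1569 / 40) (489 / 40)) := by unfold hhatc5; ring
  rw [hh, ← sN, ← s0, ← s1, ← s2, ← s3, ← s4, ← s5, ← s6]
  linarith only [aN, b0, b1, b2, b3, b4, b5, b6]

/-- **Window bound**: for `n ≥ 100` and `2n/5 − 1 ≤ μ ≤ 9n/20 + 1`,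
`H(n, μ) ≤ n·(ĥ(u₀) + Λ⁺·w) + 2Λ⁺ + 96·(1 + log(52n))`. -/
theorem Hc5E1_window_bound {n μ : ℝ} (hn : 100 ≤ n) (hlo : 9 / 40 * n - 1 ≤ μ) (hhi : μ ≤ 1 / 4 * n + 1) :
    Hc5E1 n μ ≤ n * (hhatc5 + lambdaPlusc5 * (1 / 40)) + 2 * lambdaPlusc5 + 96 * (1 + Real.log (52 * n)) := by
  have hw := Hc5E1_window_le (n := n) (μ₀ := 9 / 40 * n - 1) (μ := μ) (μ₁ := 1 / 4 * n + 1) (by linarith) (by linarith) hlo hhi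
  have hs := slopec5E1_le hn
  have hb := Hc5E1_base_le (n := n) (by linarith)
  obtain ⟨lp0, -⟩ := lambdaPlusc5_bounds
  have hδ : 0 ≤ μ - (9 / 40 * n - 1) := by linarith
  have h1 : (μ - (9 / 40 * n - 1)) * slopec5E1 n (9 / 40 * n - 1) (1 / 4 * n + 1) ≤ (μ - (9 / 40 * n - 1)) * lambdaPlusc5 :=
    mul_le_mul_of_nonneg_left hs hδ
  have h2 : (μ - (9 / 40 * n - 1)) * lambdaPlusc5 ≤ ((1 / 40) * n + 2) * lambdaPlusc5 :=
    mul_le_mul_of_nonneg_right (by linarith) (by linarith)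
  nlinarith [hw, h1, h2, hb]

end Summit.KontsevichZagierPeriods.Zeta5Search.RayC5
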